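import Mathlib
import Literature.Analysis.InnerProduct.OstrowskiCongruence
import Summits.Ventures.YMGap.FlowData.RitzDeflationCertificate

/-!
# Venture YMGap, track Y3 FLOW-DATA — the ONE-BUILD RELATIVE BRACKET («BRACKET-1») of lineage A, typed

HONEST FRAMING: venture file of the cell `pub-ymgap` (QuantumFields programme), track Y3.  Lineage A (flow-eng-1,
engine «sntm» v2.3, ENGINE.md §9.2) replaces the TWO bracketing builds `G⁻ = G(1−τ) ⪯ G_S ⪯ G(1+τ) = G⁺` of
ENGINE.md §3 (ii) (typed: `RitzDeflation.eigenvalues₀_sandwich`) by ONE build `G₁ = G(1)` and the RELATIVE Loewner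
bracket
  `(1 − x) · G₁ ⪯ G(1−τ) ⪯ G_S ⪯ G(1+τ) ⪯ (1 − x)⁻¹ · G₁`,  `x = c τ`, `c = N_sp/(w_min − 2τ)`, `0 ≤ x < 1`,
which the engine derives pointwise in the link variables (telescoping `Π_p W_p(v) − Π_p W_p(u)
= (v − u) Σ_p Π_{q<p} W_q(v) Π_{q>p} W_q(u)`, every factor a non-negative function, `W_p ≥ w_min − 2τ > 0`; ENGINE.md
§9.2 PROOF 2) and which enters here — exactly like the bracket itself in `RitzDeflationCertificate` — as the
positive-semidefiniteness HYPOTHESES `hrel_lo`, `hrel_hi` on the (never assembled) exact kept-set matrices.  What is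
typed is the finite linear algebra downstream of them:

* `smul_eigenvalues₀_le` / `eigenvalues₀_le_smul` / `eigenvalues₀_bracket1`: `a • G₁ ⪯ G ⇒ a λ↓_i(G₁) ≤ λ↓_i(G)` and
  `G ⪯ b • G₁ ⇒ λ↓_i(G) ≤ b λ↓_i(G₁)` for `a, b ≥ 0` (Loewner monotonicity + positive scaling of the sorted spectrum), chained;
* `bracket1_block_enclosure`: with ONE float build `M ≈ G₁` (entrywise dominated build error, row/column sums `≤ errG`),
  a Rayleigh–Ritz lower certificate `σ` and a deflation upper certificate `μ` on `M` (the hypotheses of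
  `RitzDeflation.block_enclosure`), and the chain above: `(1 − x)(σ − errG) ≤ λ↓_i(G_S) ≤ (μ + errG)/(1 − x)` — the
  `[T_lo, T_hi]` (before the kinetic tail) of a v2.3 `bracket1` task JSON (`constants.bracket1 = {c, x, fac_lo = 1 − x,
  fac_hi = 1/(1 − x)}`), whose lower endpoint the engine clamps at `0` using `G₁ ⪰ 0` (`bracket1_lower_clamped`);
* the factors are also valid under the Grönwall form `e^{∓cτ}` of ENGINE.md §9.2 PROOF 1, since `1 − x ≤ e^{−x}` and
  `e^{x} ≤ (1 − x)⁻¹` for `x < 1` (Mathlib's `Real.add_one_le_exp`; not restated here).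

Real symmetric matrices (the engine's); Mathlib's antitone enumeration `Matrix.IsHermitian.eigenvalues₀`.  No lattice
object, no number, no row, nothing about limits or a mass gap.

References: R. A. Horn, C. R. Johnson, *Matrix Analysis*, 2nd ed. (2013), Cor. 4.3.12 (Loewner monotonicity),
Thm. 1.1.6 (spectral scaling) [cite: HornJohnson2013, Cor 4.3.12; Thm 1.1.6]; the cell's
HOME/pub-ymgap-flow-eng-1/ENGINE.md §9.2 and `sntm_v23/tail2.py` (mode `bracket1`, 2026-08-24).
-/

noncomputable section

open Matrix Finset
open scoped BigOperators

namespace Summit.Ventures.YMGap.FlowData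

namespace RelativeBracket

open RitzDeflation
open scoped InnerProductSpace

variable {m : Type*} [Fintype m] [DecidableEq m]

/-- Positive scaling of the sorted spectrum, `λ↓_j(c • A) = c · λ↓_j(A)` for `0 ≤ c` (Ostrowski with the congruence
`√c · id`, `θ_k ∈ [c, c]`).  This is the tree's `Literature.Analysis.Matrix.EigenvalueCount.eigenvalues₀_smul_of_nonneg`
(file `Literature/Analysis/Matrix/EigenvaluesPositiveScaling.lean`), restated here with its proof only because that
module had no farm olean at filing time (2026-08-24); swap the import when it is built.
[cite: HornJohnson2013, Thm 1.1.6; Thm 4.5.9] -/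
theorem eigenvalues₀_smul_of_nonneg' {A : Matrix m m ℝ} (hA : A.IsHermitian) {c : ℝ} (hc : 0 ≤ c)
    (hcA : (c • A).IsHermitian) (j : Fin (Fintype.card m)) :
    hcA.eigenvalues₀ j = c * hA.eigenvalues₀ j := by
  have hT : (Matrix.toEuclideanLin A).IsSymmetric := Matrix.isSymmetric_toEuclideanLin_iff.mpr hA
  have hS : (Matrix.toEuclideanLin (c • A)).IsSymmetric := Matrix.isSymmetric_toEuclideanLin_iff.mpr hcA
  have hSc : Matrix.toEuclideanLin (c • A) = c • Matrix.toEuclideanLin A := map_smul _ c A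
  let G : EuclideanSpace ℝ m →ₗ[ℝ] EuclideanSpace ℝ m := Real.sqrt c • LinearMap.id
  have hG : ∀ x : EuclideanSpace ℝ m, G x = Real.sqrt c • x := fun x => rfl
  have hBG : ∀ x y : EuclideanSpace ℝ m, ⟪Matrix.toEuclideanLin (c • A) x, y⟫_ℝ =
      ⟪Matrix.toEuclideanLin A (G x), G y⟫_ℝ := by
    intro x y
    rw [hSc, LinearMap.smul_apply, hG, hG, map_smul, real_inner_smul_left, real_inner_smul_left,
      real_inner_smul_right, ← mul_assoc, Real.mul_self_sqrt hc]
  have hnorm : ∀ x : EuclideanSpace ℝ m, ‖G x‖ ^ 2 = c * ‖x‖ ^ 2 := by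
    intro x
    rw [hG, norm_smul, mul_pow, Real.norm_eq_abs, sq_abs, Real.sq_sqrt hc]
  obtain ⟨θ, h1, h2, h3⟩ := Literature.Analysis.InnerProduct.exists_eigenvalues_congr_eq_mul hT hS
    finrank_euclideanSpace G hBG (m := c) (M := c)
    (fun x => (hnorm x).symm.le) (fun x => (hnorm x).le) j
  have hθ : θ = c := le_antisymm h2 h1
  change hS.eigenvalues finrank_euclideanSpace j = c * hT.eigenvalues finrank_euclideanSpace j
  rw [h3, hθ]

/-- **Relative Loewner bound, lower half.** For real symmetric `G₁`, `G` and `0 ≤ a`: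
`a • G₁ ⪯ G ⇒ a · λ↓_i(G₁) ≤ λ↓_i(G)` for every index `i` of the antitone enumeration
(Loewner monotonicity of the sorted eigenvalues, then `λ↓_i(a • A) = a λ↓_i(A)` for `a ≥ 0`).
[cite: HornJohnson2013, Cor 4.3.12; Thm 1.1.6] -/
theorem smul_eigenvalues₀_le {G₁ G : Matrix m m ℝ} (hG₁ : G₁.IsHermitian) (hG : G.IsHermitian)
    {a : ℝ} (ha : 0 ≤ a) (hlo : (G - a • G₁).PosSemidef) (i : Fin (Fintype.card m)) :
    a * hG₁.eigenvalues₀ i ≤ hG.eigenvalues₀ i := by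
  have haH : (a • G₁).IsHermitian := by
    rw [Matrix.IsHermitian, Matrix.conjTranspose_smul, star_trivial, hG₁.eq]
  rw [← eigenvalues₀_smul_of_nonneg' hG₁ ha haH i]
  exact eigenvalues₀_mono haH hG hlo i

/-- **Relative Loewner bound, upper half.** For real symmetric `G₁`, `G` and `0 ≤ b`:
`G ⪯ b • G₁ ⇒ λ↓_i(G) ≤ b · λ↓_i(G₁)`. [cite: HornJohnson2013, Cor 4.3.12; Thm 1.1.6] -/
theorem eigenvalues₀_le_smul {G₁ G : Matrix m m ℝ} (hG₁ : G₁.IsHermitian) (hG : G.IsHermitian)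
    {b : ℝ} (hb : 0 ≤ b) (hhi : (b • G₁ - G).PosSemidef) (i : Fin (Fintype.card m)) :
    hG.eigenvalues₀ i ≤ b * hG₁.eigenvalues₀ i := by
  have hbH : (b • G₁).IsHermitian := by
    rw [Matrix.IsHermitian, Matrix.conjTranspose_smul, star_trivial, hG₁.eq]
  rw [← eigenvalues₀_smul_of_nonneg' hG₁ hb hbH i]
  exact eigenvalues₀_mono hG hbH hhi i

/-- The BRACKET-1 chain at the eigenvalue level: `(1−x) • G₁ ⪯ Gm ⪯ G ⪯ Gp ⪯ (1−x)⁻¹ • G₁` with `x < 1`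
⇒ `(1 − x) λ↓_i(G₁) ≤ λ↓_i(G) ≤ (1 − x)⁻¹ λ↓_i(G₁)`.  (`Gm`, `Gp` = the two bracketing operators `G(1∓τ)` of
ENGINE.md §3 (ii), never built in v2.3; `G₁ = G(1)` is the one build; `x = cτ`.)
[cite: HornJohnson2013, Cor 4.3.12; Thm 1.1.6] -/
theorem eigenvalues₀_bracket1 {G₁ Gm G Gp : Matrix m m ℝ} (hG₁ : G₁.IsHermitian) (hGm : Gm.IsHermitian)
    (hG : G.IsHermitian) (hGp : Gp.IsHermitian) {x : ℝ} (hx1 : x < 1)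
    (hrel_lo : (Gm - (1 - x) • G₁).PosSemidef) (hlo : (G - Gm).PosSemidef)
    (hhi : (Gp - G).PosSemidef) (hrel_hi : ((1 - x)⁻¹ • G₁ - Gp).PosSemidef) (i : Fin (Fintype.card m)) :
    (1 - x) * hG₁.eigenvalues₀ i ≤ hG.eigenvalues₀ i ∧ hG.eigenvalues₀ i ≤ (1 - x)⁻¹ * hG₁.eigenvalues₀ i := by
  have h1x : 0 ≤ 1 - x := by linarith
  have hs := eigenvalues₀_sandwich hGm hG hGp hlo hhi i
  exact ⟨(smul_eigenvalues₀_le hG₁ hGm h1x hrel_lo i).trans hs.1,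
    hs.2.trans (eigenvalues₀_le_smul hG₁ hGp (inv_nonneg.mpr h1x) hrel_hi i)⟩

/-- **BRACKET-1 block enclosure** (ENGINE.md §9.2, task mode `bracket1`).  ONE float build `M ≈ G₁` with entrywise
dominated build error (`‖(G₁ − M) i j‖ ≤ N i j`, row and column sums of `N` at most `errG`), a Rayleigh–Ritz lower
certificate `σ` (on `i + 1` float vectors `W`, `Wᴴ W ≻ 0`, `Wᴴ M W − σ Wᴴ W ⪰ 0`) and a deflation upper certificate
`μ` (`μ·1 − M + Σ_{l<k} c_l v_l v_lᴴ ⪰ 0`, `k ≤ i`) — the hypotheses of `RitzDeflation.block_enclosure` — together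
with the relative bracket chain `(1−x) • G₁ ⪯ Gm ⪯ G ⪯ Gp ⪯ (1−x)⁻¹ • G₁`, `x < 1`, give
`(1 − x)(σ − errG) ≤ λ↓_i(G) ≤ (1 − x)⁻¹ (μ + errG)` for the never-assembled exact kept-set block `G`.
[cite: HornJohnson2013, Thm 4.2.6; Thm 4.3.1; Cor 4.3.12; Thm 1.1.6] -/
theorem bracket1_block_enclosure {G₁ Gm G Gp M : Matrix m m ℝ} (hG₁ : G₁.IsHermitian) (hGm : Gm.IsHermitian)
    (hG : G.IsHermitian) (hGp : Gp.IsHermitian) (hM : M.IsHermitian) {x : ℝ} (hx1 : x < 1)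
    (hrel_lo : (Gm - (1 - x) • G₁).PosSemidef) (hlo : (G - Gm).PosSemidef)
    (hhi : (Gp - G).PosSemidef) (hrel_hi : ((1 - x)⁻¹ • G₁ - Gp).PosSemidef)
    (N : Matrix m m ℝ) (hdom : ∀ i j, ‖(G₁ - M) i j‖ ≤ N i j) {errG : ℝ}
    (hrow : ∀ i, ∑ j, N i j ≤ errG) (hcol : ∀ j, ∑ i, N i j ≤ errG)
    {ι : Type*} [Fintype ι] [DecidableEq ι]
    (W : Matrix m ι ℝ) (hW : (Wᴴ * W).PosDef) {σ : ℝ} (hritz : (Wᴴ * M * W - σ • (Wᴴ * W)).PosSemidef)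
    {k : ℕ} (v : Fin k → m → ℝ) (c : Fin k → ℝ) {μ : ℝ}
    (hdefl : (μ • (1 : Matrix m m ℝ) - M + ∑ j, (c j) • vecMulVec (v j) (star (v j))).PosSemidef)
    (i : Fin (Fintype.card m)) (hιi : (i : ℕ) + 1 ≤ Fintype.card ι) (hki : k ≤ (i : ℕ)) :
    (1 - x) * (σ - errG) ≤ hG.eigenvalues₀ i ∧ hG.eigenvalues₀ i ≤ (1 - x)⁻¹ * (μ + errG) := by
  have h1x : 0 ≤ 1 - x := by linarith
  have hb := block_enclosure hG₁ hM N hdom hrow hcol W hW hritz v c hdefl i hιi hki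
  have hc := eigenvalues₀_bracket1 hG₁ hGm hG hGp hx1 hrel_lo hlo hhi hrel_hi i
  exact ⟨(mul_le_mul_of_nonneg_left hb.1 h1x).trans hc.1,
    hc.2.trans (mul_le_mul_of_nonneg_left hb.2 (inv_nonneg.mpr h1x))⟩

/-- Non-negativity of the sorted spectrum of a positive semidefinite real matrix, in the `eigenvalues₀` enumeration
(Mathlib's `PosSemidef.eigenvalues_nonneg` is stated for the `n`-indexed `eigenvalues`). [folklore] -/
theorem eigenvalues₀_nonneg_of_posSemidef {A : Matrix m m ℝ} (hA : A.PosSemidef) (i : Fin (Fintype.card m)) :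
    0 ≤ hA.1.eigenvalues₀ i := by
  have h := hA.eigenvalues_nonneg ((Fintype.equivOfCardEq (Fintype.card_fin _)) i)
  simpa [Matrix.IsHermitian.eigenvalues] using h

/-- The clamped lower endpoint the engine prints (`T_lo = max(lo, 0)·fac_lo`): if moreover `G₁ ⪰ 0` (the one build is a
compression of a product of POSITIVE multiplication operators, `W_p(1) ≥ w_min − τ > 0`) and `lo ≤ λ↓_i(G₁)` is the
certified lower bound of the one build, then `(1 − x)·max(lo, 0) ≤ λ↓_i(G)`.
[cite: HornJohnson2013, Cor 4.3.12; Thm 1.1.6] -/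
theorem bracket1_lower_clamped {G₁ Gm G : Matrix m m ℝ} (hpsd : G₁.PosSemidef) (hGm : Gm.IsHermitian)
    (hG : G.IsHermitian) {x : ℝ} (hx1 : x < 1)
    (hrel_lo : (Gm - (1 - x) • G₁).PosSemidef) (hlo : (G - Gm).PosSemidef)
    (i : Fin (Fintype.card m)) {lo : ℝ} (hcert : lo ≤ hpsd.1.eigenvalues₀ i) :
    (1 - x) * max lo 0 ≤ hG.eigenvalues₀ i := by
  have h1x : 0 ≤ 1 - x := by linarith
  have hmax : max lo 0 ≤ hpsd.1.eigenvalues₀ i := max_le hcert (eigenvalues₀_nonneg_of_posSemidef hpsd i)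
  calc (1 - x) * max lo 0 ≤ (1 - x) * hpsd.1.eigenvalues₀ i := mul_le_mul_of_nonneg_left hmax h1x
    _ ≤ hGm.eigenvalues₀ i := smul_eigenvalues₀_le hpsd.1 hGm h1x hrel_lo i
    _ ≤ hG.eigenvalues₀ i := eigenvalues₀_mono hGm hG hlo i

end RelativeBracket

end Summit.Ventures.YMGap.FlowData

end
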